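import Mathlib
import HarnessLib
import Summits.HubbardSuperconductivity.HubbardSuperconductivity.Theses.InfiniteVolumeFirst
import Summits.HubbardSuperconductivity.HubbardSuperconductivity.Theorems.FunctionFieldCertificateWindowInfraredBoundOneSidedFloor

/-!
# Crux `NoInfraredPileUp` (stmt-HubbardSuperconductivity-18534, route `InfiniteVolumeFirst`) —
# the Feynman–Bijl / moment-method engines of `WindowInfraredBound` AT WEAK COUPLING ONLY

The soft tightness crux `NoInfraredPileUp` (`∀ δ ∃ U₁ ∀ U ∈ (0,U₁) ∀` admissible families
`∀ η ∃ ε, L₀`: `Σ_{m≠0,|q_m|≤ε} S_ψ(m) ≤ ηL²`) is implied by the linear window infrared bound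
`WindowInfraredBound` (stmt-1089: `Σ ≤ CεL²` for EVERY `U > 0`; landed glue
`stub_noInfraredPileUp_of_windowInfraredBound`). The sister crux stmt-1089 carries a landed,
sorry-free reduction machinery (`Theorems/FunctionFieldCertificateWindowInfraredBound{Reductions,Engines,
OneSidedFloor,EngineB}.lean`): the pointwise GOLDSTONE SHAPE `S_ψ(m)·|q_m| ≤ A` closes the window sum by
the punctured lattice sum `Σ_{0<|q|≤ε}|q|⁻¹ ≤ 32εL²` (`windowSum_le_of_goldstoneShape`), and two engines
deliver the shape in every sector ground state from ONE open `O(1)` physics input each plus pair convexity: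
Engine A′ (`goldstoneShape_of_pairRemovalFloor`: one-sided pair-removal Landau floor `c|q|` + `pairGap ≥ 0`,
reversed Feynman–Bijl with the landed double-commutator ceiling `stub_doubleCommBound`) and Engine B
(`goldstoneShape_of_momentClosure`: variational torus pair stiffness `C_X L²/|q|²` + charging floor
`pairGap ≥ -κ/L`, Pitaevskii–Stringari moment closure with the landed budgets).

Those engine theorems are POINTWISE in `(U, δ)`; the crux here never needs `U ≥ U₁(δ)`. This file records
the weak-coupling instantiations, i.e. the same reductions with every hypothesis demanded only for
`U ∈ (0, U₁(δ))` — the exact open inputs on which stmt-18534 (not only stmt-1089) now formally rests: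

* `stub_noInfraredPileUp_of_wibAtWeakCoupling` — the window bound `≤ CεL²` at weak coupling only ⇒ crux
  (pointwise sharpening of the landed glue, which consumed stmt-1089 at all `U`);
* `stub_noInfraredPileUp_of_goldstoneShapeAtWeakCoupling` — the pointwise shape `S_ψ(m)|q_m| ≤ A` on
  `0 < |q_m| ≤ ε₀`, in every normalised `(N_L,0)`-sector ground state, eventually in even `L`, for
  `U ∈ (0,U₁(δ))` ⇒ crux (`ε := min ε₀ (η/(32A+1))`);
* `stub_noInfraredPileUp_of_pairRemovalFloor_of_pairConvexity` — Engine A′ at weak coupling: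
  (Y₋) `Re⟨Δ_d(m)ψ, HΔ_d(m)ψ⟩ ≥ (E(N_L-2) + c|q_m|)‖Δ_d(m)ψ‖²` and (Cvx) `pairGap H N_L ≥ 0`, both for
  `U ∈ (0,U₁(δ))` only ⇒ crux;
* `stub_noInfraredPileUp_of_torusPairStiffness_of_chargingFloor` — Engine B at weak coupling:
  (T) the variational torus pair stiffness on `(N_L ∓ 2, 0)` and (Ch) `pairGap H N_L ≥ -κ/L`, both for
  `U ∈ (0,U₁(δ))` only ⇒ crux (the two-particle cost (F3) is the landed
  `WcbcsSsbToTorusLRO.tpc_torus_summit`).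

All four are compositions of landed theorems (no definition, no named fact, no sorry); nothing here
claims (Y₋), (Cvx), (T) or (Ch) — they are the OPEN `O(1)`-total-energy inputs (phase stiffness /
Landau floor of the exact ground state, discrete pair convexity), exactly as for stmt-1089, and they
remain behind the twist wall (`Theorems/NoInfraredPileUp/Negative/NearGroundStates.lean`).
Sources: R. P. Feynman, Phys. Rev. 94 (1954) 262; L. Pitaevskii, S. Stringari, J. Low Temp. Phys. 85
(1991) 377; T. Kennedy, E. H. Lieb, B. S. Shastry, PRL 61 (1988) 2582 (infrared-bound shape).
-/

-- the mandated namespace `Summit.<Summit>.<Problem>.Theorems` repeats `HubbardSuperconductivity`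
-- (single-problem summit, D-0017), which the `dupNamespace` linter flags on every declaration
set_option linter.dupNamespace false

namespace Summit.HubbardSuperconductivity.HubbardSuperconductivity.Theorems.NoInfraredPileUp

open Summit.HubbardSuperconductivity.HubbardSuperconductivity.Theses
open Literature.MathematicalPhysics.QuantumLattice Literature.Probability.LatticeModels Matrix Finset
open scoped ComplexOrder ComplexConjugate

/-! ### §1 The window bound, needed at weak coupling only -/

/-- **Linear window bound at weak coupling ⇒ `NoInfraredPileUp`.** If for every `δ ∈ (0,1/2)` there is
`U₁ > 0` such that for every `U ∈ (0,U₁)` the body of `WindowInfraredBound` holds at `(U, δ)` (constants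
`C ≥ 0`, `ε₀ > 0`, `L₀`; window sum `≤ CεL²` for `ε ∈ (0,ε₀]`, even `L ≥ L₀`, every normalised
`(N_L,0)`-sector ground state), then the crux holds: given `η > 0` take `ε := min ε₀ (η/(C+1))`.
Pointwise-in-`U` sharpening of the landed `stub_noInfraredPileUp_of_windowInfraredBound`. [folklore] -/
theorem stub_noInfraredPileUp_of_wibAtWeakCoupling : (∀ δ ∈ Set.Ioo (0:ℝ) (1 / 2), ∃ U₁ : ℝ, 0 < U₁ ∧ ∀ U ∈ Set.Ioo (0:ℝ) U₁, ∃ C ε₀ : ℝ, 0 ≤ C ∧ 0 < ε₀ ∧ ∃ L₀ : ℕ, ∀ ε ∈ Set.Ioc (0:ℝ) ε₀, ∀ (L : ℕ) [NeZero L], L₀ ≤ L → Even L → ∀ ψ : Fock (Orb (FermionTorus 2 L)), star ψ ⬝ᵥ ψ = 1 → IsGroundStateInSector (hubbardTorus 2 L 1 U) (2 * ⌊(1 - δ) * (L : ℝ) ^ 2 / 2⌋₊) 0 ψ → (∑ m : TorusSite 2 L, if m ≠ 0 ∧ momentumNormSq L m ≤ ε ^ 2 then pairStructureFactor dWaveFormFactor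 L ψ m else 0) ≤ C * ε * (L : ℝ) ^ 2) → Summit.HubbardSuperconductivity.HubbardSuperconductivity.Theses.InfiniteVolumeFirst.NoInfraredPileUp := by
  intro h δ hδ
  obtain ⟨U₁, hU₁, hW⟩ := h δ hδ
  refine ⟨U₁, hU₁, fun U hU N ψ hadm η hη => ?_⟩
  obtain ⟨C, ε₀, hC, hε₀, L₀, hL₀⟩ := hW U hU
  have hC1 : 0 < C + 1 := by linarith
  have hεpos : 0 < min ε₀ (η / (C + 1)) := lt_min hε₀ (div_pos hη hC1)
  refine ⟨min ε₀ (η / (C + 1)), hεpos, L₀, fun L _ hL hLL => ?_⟩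
  have hadmL := hadm L hL
  have hgs : IsGroundStateInSector (hubbardTorus 2 L 1 U) (2 * ⌊(1 - δ) * (L : ℝ) ^ 2 / 2⌋₊) 0
      (ψ L) := hadmL.1 ▸ hadmL.2.2
  have key := hL₀ _ ⟨hεpos, min_le_left _ _⟩ L hLL hL (ψ L) hadmL.2.1 hgs
  have hCε : C * min ε₀ (η / (C + 1)) * (L : ℝ) ^ 2 ≤ η * (L : ℝ) ^ 2 := by
    refine mul_le_mul_of_nonneg_right ?_ (sq_nonneg _)
    calc C * min ε₀ (η / (C + 1)) ≤ C * (η / (C + 1)) :=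
          mul_le_mul_of_nonneg_left (min_le_right _ _) hC
      _ ≤ (C + 1) * (η / (C + 1)) :=
          mul_le_mul_of_nonneg_right (by linarith) (div_pos hη hC1).le
      _ = η := by field_simp
  exact le_trans key hCε

/-! ### §2 The pointwise Goldstone shape, needed at weak coupling only -/

/-- **Goldstone shape at weak coupling ⇒ `NoInfraredPileUp`.** If for every `δ ∈ (0,1/2)` there is
`U₁ > 0` such that for every `U ∈ (0,U₁)` there are `A ≥ 0`, `ε₀ > 0`, `L₀` with the pointwise infrared
bound `S_ψ(m)·|q_m| ≤ A` for every even `L ≥ L₀`, every normalised `(N_L,0)`-sector ground state `ψ` of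
`hubbardTorus 2 L 1 U` and every `0 < |q_m| ≤ ε₀`, then the crux holds: the window sum is `≤ 32AεL²`
(landed `windowSum_le_of_goldstoneShape`, lattice sum `Σ_{0<|q|≤ε}|q|⁻¹ ≤ 32εL²`), so
`ε := min ε₀ (η/(32A+1))` does it. Kennedy–Lieb–Shastry, PRL 61 (1988) 2582 (shape). [folklore] -/
theorem stub_noInfraredPileUp_of_goldstoneShapeAtWeakCoupling : (∀ δ ∈ Set.Ioo (0:ℝ) (1 / 2), ∃ U₁ : ℝ, 0 < U₁ ∧ ∀ U ∈ Set.Ioo (0:ℝ) U₁, ∃ A ε₀ : ℝ, 0 ≤ A ∧ 0 < ε₀ ∧ ∃ L₀ : ℕ, ∀ (L : ℕ) [NeZero L], L₀ ≤ L → Even L → ∀ ψ : Fock (Orb (FermionTorus 2 L)), star ψ ⬝ᵥ ψ = 1 → IsGroundStateInSector (hubbardTorus 2 L 1 U) (2 * ⌊(1 - δ) * (L : ℝ) ^ 2 / 2⌋₊) 0 ψ → ∀ m : TorusSite 2 L, m ≠ 0 → momentumNormSq L m ≤ ε₀ ^ 2 → pairStructureFactor dWaveFormFactor L ψ m * Real.sqrt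 (momentumNormSq L m) ≤ A) → Summit.HubbardSuperconductivity.HubbardSuperconductivity.Theses.InfiniteVolumeFirst.NoInfraredPileUp := by
  intro h
  refine stub_noInfraredPileUp_of_wibAtWeakCoupling fun δ hδ => ?_
  obtain ⟨U₁, hU₁, hS⟩ := h δ hδ
  refine ⟨U₁, hU₁, fun U hU => ?_⟩
  obtain ⟨A, ε₀, hA, hε₀, L₀, hL⟩ := hS U hU
  refine ⟨32 * A, ε₀, by positivity, hε₀, L₀, fun ε hε L _ hL₀ hev ψ hψ1 hψ => ?_⟩
  have hw := windowSum_le_of_goldstoneShape L hε.1 hε.2 hA ψ (hL L hL₀ hev ψ hψ1 hψ)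
  linarith [hw]

/-! ### §3 Engine A′ at weak coupling — one-sided pair-removal Landau floor + pair convexity -/

/-- **Engine A′ at weak coupling ⇒ `NoInfraredPileUp`.** HYPOTHESES, for every `δ ∈ (0,1/2)` only for
`U ∈ (0, U₁(δ))`, eventually along even sides, for every normalised `(N_L,0)`-sector ground state `ψ`
of `H = hubbardTorus 2 L 1 U` (`E(M) = minEnergyOn H (szSector M 0)`): (Y₋) the PAIR-REMOVAL LANDAU
FLOOR at every window momentum `0 < |q_m| ≤ η`, `Re⟨Δ_d(m)ψ, HΔ_d(m)ψ⟩ ≥ (E(N_L-2) + c|q_m|)‖Δ_d(m)ψ‖²`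
(removing a `d`-wave pair at total momentum `q ≠ 0` costs `≥ c|q|`: phase mode / two nodal
quasiparticles — the open physics input), and (Cvx) PAIR CONVEXITY `pairGap H N_L ≥ 0`. CONCLUSION:
the crux, through the landed `goldstoneShape_of_pairRemovalFloor` (reversed Feynman–Bijl at
`μ₊ = (E(N_L+2)-E(N_L))/2`, landed `stub_doubleCommBound`, `|μ₊| ≤ 144(2+|U|)` from the landed
two-particle cost) and §2. Feynman (1954); Pitaevskii–Stringari (1991). [folklore] -/
theorem stub_noInfraredPileUp_of_pairRemovalFloor_of_pairConvexity : (∀ δ ∈ Set.Ioo (0:ℝ) (1 / 2), ∃ U₁ : ℝ, 0 < U₁ ∧ ∀ U ∈ Set.Ioo (0:ℝ) U₁, ∃ c η : ℝ, 0 < c ∧ 0 < η ∧ ∃ L₀ : ℕ, ∀ (L : ℕ) [NeZero L], L₀ ≤ L → Even L → ∀ ψ : Fock (Orb (FermionTorus 2 L)), star ψ ⬝ᵥ ψ = 1 → IsGroundStateInSector (hubbardTorus 2 L 1 U) (2 * ⌊(1 - δ) * (L : ℝ) ^ 2 / 2⌋₊) 0 ψ → ∀ m : TorusSite 2 L, m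 ≠ 0 → momentumNormSq L m ≤ η ^ 2 → ((hubbardTorus 2 L 1 U).minEnergyOn (szSector (2 * ⌊(1 - δ) * (L : ℝ) ^ 2 / 2⌋₊ - 2) 0) + c * Real.sqrt (momentumNormSq L m)) * (star (pairFieldAt dWaveFormFactor L m *ᵥ ψ) ⬝ᵥ (pairFieldAt dWaveFormFactor L m *ᵥ ψ)).re ≤ (star (pairFieldAt dWaveFormFactor L m *ᵥ ψ) ⬝ᵥ (hubbardTorus 2 L 1 U *ᵥ (pairFieldAt dWaveFormFactor L m *ᵥ ψ))).re) → (∀ δ ∈ Set.Ioo (0:ℝ) (1 / 2), ∃ U₁ : ℝ, 0 < U₁ ∧ ∀ U ∈ Set.Ioo (0:ℝ) U₁, ∃ L₀ : ℕ, ∀ (L : ℕ) [NeZero L], L₀ ≤ L → Even L → 0 ≤ pairGap (hubbardTorus 2 L 1 U) (2 * ⌊(1 - δ) * (L : ℝ) ^ 2 / 2⌋₊)) → Summit.HubbardSuperconductivity.HubbardSuperconductivity.Theses.InfiniteVolumeFirst.NoInfraredPileUp := by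
  intro hY hCvx
  refine stub_noInfraredPileUp_of_goldstoneShapeAtWeakCoupling fun δ hδ => ?_
  obtain ⟨U₁, hU₁, hY₁⟩ := hY δ hδ
  obtain ⟨U₂, hU₂, hC₂⟩ := hCvx δ hδ
  refine ⟨min U₁ U₂, lt_min hU₁ hU₂, fun U hU => ?_⟩
  have hUA : U ∈ Set.Ioo (0:ℝ) U₁ := ⟨hU.1, hU.2.trans_le (min_le_left _ _)⟩
  have hUB : U ∈ Set.Ioo (0:ℝ) U₂ := ⟨hU.1, hU.2.trans_le (min_le_right _ _)⟩
  obtain ⟨c, η, hc, hη, L₁, hY'⟩ := hY₁ U hUA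
  obtain ⟨L₂, hCvx'⟩ := hC₂ U hUB
  obtain ⟨C, hC, hB⟩ := stub_doubleCommBound U hU.1
  set T : ℝ := 16 * (((2 * 4 + 1 : ℕ) : ℝ) * (2 * (2 * |(1 : ℝ)| + |U|))) with hT
  have hT0 : 0 ≤ T := by positivity
  refine ⟨C * (1 + T / 2) / c, η, by positivity, hη, max (max L₁ L₂) 4,
    fun L _ hL₀ hev ψ hψ1 hψ m hm0 hmη => ?_⟩
  have hL₁ : L₁ ≤ L := le_trans (le_max_left _ _) ((le_max_left _ _).trans hL₀)
  have hL₂ : L₂ ≤ L := le_trans (le_max_right _ _) ((le_max_left _ _).trans hL₀)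
  have hL4 : 4 ≤ L := (le_max_right _ _).trans hL₀
  have hN : 2 ≤ 2 * ⌊(1 - δ) * (L : ℝ) ^ 2 / 2⌋₊ := wib_two_le_summitFilling hδ (by omega)
  have hshape := goldstoneShape_of_pairRemovalFloor hN hψ hψ1 hm0 hc (fun μ => hB L μ m ψ)
    (hCvx' L hL₂ hev) (hY' L hL₁ hev ψ hψ1 hψ m hm0 hmη)
  -- `|μ₊| ≤ T/2` from the landed two-particle cost
  have hcost := (WcbcsSsbToTorusLRO.tpc_torus_summit U δ hδ L hL4).2
  have hμ : |((hubbardTorus 2 L 1 U).minEnergyOn (szSector (2 * ⌊(1 - δ) * (L : ℝ) ^ 2 / 2⌋₊ + 2) 0) -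
      (hubbardTorus 2 L 1 U).minEnergyOn (szSector (2 * ⌊(1 - δ) * (L : ℝ) ^ 2 / 2⌋₊) 0)) / 2| ≤
      T / 2 := by
    rw [abs_div, abs_two]
    exact div_le_div_of_nonneg_right hcost zero_le_two
  refine hshape.trans (div_le_div_of_nonneg_right ?_ hc.le)
  exact mul_le_mul_of_nonneg_left (by linarith [hμ]) hC

/-! ### §4 Engine B at weak coupling — torus pair stiffness + charging floor -/

/-- **Engine B at weak coupling ⇒ `NoInfraredPileUp`.** HYPOTHESES, for every `δ ∈ (0,1/2)` only for
`U ∈ (0, U₁(δ))`, eventually along even sides, for every normalised `(N_L,0)`-sector ground state `ψ`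
of `H = hubbardTorus 2 L 1 U`: (T) the variational TORUS PAIR STIFFNESS at every window momentum
`0 < |q_m| ≤ η`, `2Re⟨w,Δ_d(m)ψ⟩ - Re⟨w,(H - E(N_L∓2))w⟩ ≤ C_X L²/|q_m|²` for all `w` in `(N_L∓2, 0)`
(optimised over `w`: the static pair susceptibility `≤ C_X L²/|q|²`, the Goldstone / Gaussian-domination
form — the open physics input), and (Ch) the CHARGING FLOOR `pairGap H N_L ≥ -κ/L`. CONCLUSION: the
crux, through the landed `goldstoneShape_of_momentClosure` (Pitaevskii–Stringari closure
`WcbcsSsbToTorusLRO.stub_momentClosure` with the landed budgets `stub_doubleCommBound` at `μ = 0`,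
`WcbcsSsbToTorusLRO.stub_pairCommutatorBudget`, and the landed two-particle cost
`WcbcsSsbToTorusLRO.tpc_torus_summit`) and §2. Pitaevskii–Stringari, J. Low Temp. Phys. 85 (1991) 377;
Kennedy–Lieb–Shastry (1988). [folklore] -/
theorem stub_noInfraredPileUp_of_torusPairStiffness_of_chargingFloor : (∀ δ ∈ Set.Ioo (0:ℝ) (1 / 2), ∃ U₁ : ℝ, 0 < U₁ ∧ ∀ U ∈ Set.Ioo (0:ℝ) U₁, ∃ C_X η : ℝ, 0 ≤ C_X ∧ 0 < η ∧ ∃ L₀ : ℕ, ∀ (L : ℕ) [NeZero L], L₀ ≤ L → Even L → ∀ ψ : Fock (Orb (FermionTorus 2 L)), star ψ ⬝ᵥ ψ = 1 → IsGroundStateInSector (hubbardTorus 2 L 1 U) (2 * ⌊(1 - δ) * (L : ℝ) ^ 2 / 2⌋₊) 0 ψ → ∀ m : TorusSite 2 L, m ≠ 0 → momentumNormSq L m ≤ η ^ 2 → (∀ w : Fock (Orb (FermionTorus 2 L)), w ∈ szSector (Λ := FermionTorus 2 L) (2 * ⌊(1 - δ) * (L : ℝ) ^ 2 / 2⌋₊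 - 2) 0 → 2 * (star w ⬝ᵥ (pairFieldAt dWaveFormFactor L m *ᵥ ψ)).re - ((star w ⬝ᵥ (hubbardTorus 2 L 1 U *ᵥ w)).re - (hubbardTorus 2 L 1 U).minEnergyOn (szSector (2 * ⌊(1 - δ) * (L : ℝ) ^ 2 / 2⌋₊ - 2) 0) * (star w ⬝ᵥ w).re) ≤ C_X * (L : ℝ) ^ 2 / momentumNormSq L m) ∧ (∀ w : Fock (Orb (FermionTorus 2 L)), w ∈ szSector (Λ := FermionTorus 2 L) (2 * ⌊(1 - δ) * (L : ℝ) ^ 2 / 2⌋₊ + 2) 0 → 2 * (star w ⬝ᵥ ((pairFieldAt dWaveFormFactor L m)ᴴ *ᵥ ψ)).re - ((star w ⬝ᵥ (hubbardTorus 2 L 1 U *ᵥ w)).re - (hubbardTorus 2 L 1 U).minEnergyOn (szSector (2 * ⌊(1 - δ) * (L : ℝ) ^ 2 / 2⌋₊ + 2) 0) * (star w ⬝ᵥ w).re) ≤ C_X * (L : ℝ) ^ 2 / momentumNormSq L m)) → (∀ δ ∈ Set.Ioo (0:ℝ) (1 / 2), ∃ U₁ : ℝ, 0 < U₁ ∧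 ∀ U ∈ Set.Ioo (0:ℝ) U₁, ∃ κ : ℝ, 0 ≤ κ ∧ ∃ L₀ : ℕ, ∀ (L : ℕ) [NeZero L], L₀ ≤ L → Even L → -(κ / (L : ℝ)) ≤ pairGap (hubbardTorus 2 L 1 U) (2 * ⌊(1 - δ) * (L : ℝ) ^ 2 / 2⌋₊)) → Summit.HubbardSuperconductivity.HubbardSuperconductivity.Theses.InfiniteVolumeFirst.NoInfraredPileUp := by
  intro hT hCh
  refine stub_noInfraredPileUp_of_goldstoneShapeAtWeakCoupling fun δ hδ => ?_
  obtain ⟨U₁, hU₁, hT₁⟩ := hT δ hδ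
  obtain ⟨U₂, hU₂, hC₂⟩ := hCh δ hδ
  refine ⟨min U₁ U₂, lt_min hU₁ hU₂, fun U hU => ?_⟩
  have hUA : U ∈ Set.Ioo (0:ℝ) U₁ := ⟨hU.1, hU.2.trans_le (min_le_left _ _)⟩
  have hUB : U ∈ Set.Ioo (0:ℝ) U₂ := ⟨hU.1, hU.2.trans_le (min_le_right _ _)⟩
  obtain ⟨C_X, η, hCX, hη, L₁, hT'⟩ := hT₁ U hUA
  obtain ⟨κ, hκ, L₂, hCh'⟩ := hC₂ U hUB
  obtain ⟨C, hC, hB⟩ := stub_doubleCommBound U hU.1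
  obtain ⟨B, hB0, hPCB⟩ := WcbcsSsbToTorusLRO.stub_pairCommutatorBudget
  set C₃ : ℝ := 16 * (((2 * 4 + 1 : ℕ) : ℝ) * (2 * (2 * |(1 : ℝ)| + |U|))) with hC₃def
  have hC₃ : 0 ≤ C₃ := by positivity
  refine ⟨Real.sqrt ((C + C₃ * B) * C_X) + κ * C_X / Real.pi, η, by positivity, hη,
    max (max L₁ L₂) 4, fun L _ hL₀ hev ψ hψ1 hψ m hm0 hmη => ?_⟩
  have hL₁ : L₁ ≤ L := le_trans (le_max_left _ _) ((le_max_left _ _).trans hL₀)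
  have hL₂ : L₂ ≤ L := le_trans (le_max_right _ _) ((le_max_left _ _).trans hL₀)
  have hL4 : 4 ≤ L := (le_max_right _ _).trans hL₀
  obtain ⟨hTm, hTp⟩ := hT' L hL₁ hev ψ hψ1 hψ m hm0 hmη
  -- (F1) at `μ = 0`
  have hF1 : (star ψ ⬝ᵥ (((pairFieldAt dWaveFormFactor L m)ᴴ *
        (hubbardTorus 2 L 1 U * pairFieldAt dWaveFormFactor L m -
          pairFieldAt dWaveFormFactor L m * hubbardTorus 2 L 1 U) -
        (hubbardTorus 2 L 1 U * pairFieldAt dWaveFormFactor L m -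
          pairFieldAt dWaveFormFactor L m * hubbardTorus 2 L 1 U) *
        (pairFieldAt dWaveFormFactor L m)ᴴ) *ᵥ ψ)).re ≤ C * (L : ℝ) ^ 2 := by
    have h := hB L 0 m ψ
    rw [hubbardTorusWith_zero, hψ1, Complex.one_re, mul_one, abs_zero, add_zero, mul_one] at h
    exact (le_abs_self _).trans h
  -- (F2)
  have hF2 : |(star ψ ⬝ᵥ (((pairFieldAt dWaveFormFactor L m)ᴴ * pairFieldAt dWaveFormFactor L m -
        pairFieldAt dWaveFormFactor L m * (pairFieldAt dWaveFormFactor L m)ᴴ) *ᵥ ψ)).re| ≤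
        B * (L : ℝ) ^ 2 := by
    have h := hPCB L m ψ
    rwa [hψ1, Complex.one_re, mul_one] at h
  -- (F3) from the landed two-particle cost
  have hF3 : |(hubbardTorus 2 L 1 U).minEnergyOn (szSector (2 * ⌊(1 - δ) * (L : ℝ) ^ 2 / 2⌋₊) 0) -
      (hubbardTorus 2 L 1 U).minEnergyOn (szSector (2 * ⌊(1 - δ) * (L : ℝ) ^ 2 / 2⌋₊ - 2) 0)| ≤ C₃ :=
    (WcbcsSsbToTorusLRO.tpc_torus_summit U δ hδ L hL4).1
  exact goldstoneShape_of_momentClosure (wib_two_le_summitFilling hδ (by omega)) hψ hψ1 hm0 hCX hC hB0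
    hC₃ hκ hTm hTp hF1 hF2 hF3 (hCh' L hL₂ hev)

end Summit.HubbardSuperconductivity.HubbardSuperconductivity.Theorems.NoInfraredPileUp
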